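import Summits.CriticalPhenomena.PercolationContinuityZ3.Theorems.PercNearOneGluingAdditiveGluingGenPair
import Literature.Probability.Percolation.KozmaNitzanSeparatingTriple
import HarnessLib

/-!
# The POCKET FOUR-POINT TRANSFER: `Cov(F(C x), 1{x↔o}) ≥ μ(o↔y, y↮x)·(E[F(C x) | o↮{x,y}] − E[F(C x) | x,y,o pairwise separated])`

Support file (`--supports stmt-CriticalPhenomena-4575`, closed crux; independent mathematics on Kozma–Nitzan's Question 8), prover
`prim-ineq-gen-6` (gen 13).  No definitions, no named facts, no sorries; standard axioms.  Memo `prim-ineq-gen-6/FINDING-G13.md` §8(iv).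
Companion of `…KnQuestion8PocketZFree.lean` (prim-lf-2, `PocketCert.pcov_zfree` = (PC0)).

Setting: one percolation `μ = prodBernoulli w`, owner `x`, observer `o`, marker `y`, `F` monotone nonnegative on vertex sets, `I_S = ∫_S F(C x)`,
cells `O = {x↔o}`, `Y' = {x↔y} ∩ {x↮o}`, `E3 = {x↮o} ∩ {x↮y} ∩ {o↮y}`, `R = {x↮o} ∩ {x↮y} ∩ {o↔y}` (`= {o∈C y, y↮x}`),
`N = {o↮x} ∩ {o↮y} = Y' ⊔ E3` (the `z`-free POCKET event of `o`: its cluster avoids `x` and `y`).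
* `PocketCert.pocket_fourPoint` — **(STRONG₀)**  `μ(R)·(μ(E3)·I_N − μ(N)·I_{E3}) ≤ μ(E3)·μ(N)·(I_O − μ(O)·∫F)`, i.e.
  `Cov(F(C x), 1{x↔o}) ≥ μ(o↔y, y↮x) · ( E[F(C x) | N] − E[F(C x) | N, x↮y] )`:
  the four-point transfer `AGloc.surplusTransfer_single` (`Cov(F,1{x↔o}) ≥ μ(o↔y,y↮x)·(E F − E[F | x↮y])`) with the marker depression
  `E F − E[F | x↮y]` replaced by the POCKET-CONDITIONED depression `E[F | N] − E[F | N, x↮y]` (neither implies the other; the comparison of the two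
  depressions fails in 30 % of random instances, memo §8).  It implies lf-2's (PC0) (`pcov_zfree`), whose observer bracket
  `I_O − μ(O)·E[F | N] ≥ I_O − μ(O)·∫F` by Harris, and it is the `z`-free core ("J1₀") of the joint-world split of the pocket covariance
  comparison PCOV (memo §8).  PROOF (exact identity, memo §8(iv)):
  `μ(E3)μ(N)(I_O − μ(O)∫F) − μ(R)(μ(E3) I_N − μ(N) I_{E3}) = μ(E3)(μ(N) + μ(R))·[I_{O⊔R} − μ(O⊔R)·∫F] + μ(N)·[μ(R)·I_{E3⊔R} − μ(E3⊔R)·I_R]`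
  (using `Ω = O ⊔ R ⊔ Y' ⊔ E3`); the first bracket is HARRIS for the increasing event `O ⊔ R = {o↔x} ∪ {o↔y}` (`AGloc.setIntegral_clusterFun_ge`), the
  second is van den Berg–Häggström–Kahn's Theorem 2.1 at `q = 1` for `S = {x}`, `T = {o,y}` (`BHK2006_twoSetConditionalAssociation.negCorrelation`) —
  the same two rows as (PC0) with the coefficients `(μ(E3)(μ(N)+μ(R)), μ(N))` in place of `(μ(E3), μ(N))`.
Census (exact partition engine, all increasing `F` via min over up-sets, n ≤ 7, ≈ 7 000 instances incl. near-one weights): 0 violations; with further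
"spectator" vertices avoided by the pocket the statement still holds numerically but is no longer this two-row identity.
[cite: VandenbergHaggstromKahn2005, Thm. 2.1 (p. 9), Thm. 1.4 (p. 7), §1 p. 6] [cite: KozmaNitzan2024, Question 8 (§5.5 p. 36), §5.1 (pp. 31–32)]
-/

namespace Summit.CriticalPhenomena.PercolationContinuityZ3.Theorems

open MeasureTheory Set Literature.Probability.LatticeModels Literature.Probability.Percolation
open scoped Classical
open KNPreFKG

noncomputable section

namespace PocketCert

variable {V : Type*} [Fintype V]

/-- **(STRONG₀) — the pocket four-point transfer.**  Owner `x`, observer `o`, marker `y`, `F` monotone nonnegative;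
`O = {x↔o}`, `Y' = {x↔y} ∩ {x↮o}`, `E3 = {x↮o} ∩ {x↮y} ∩ {o↮y}`, `R = {x↮o} ∩ {x↮y} ∩ {o↔y}`, `N = {o↮x} ∩ {o↮y}`.  Then
`μ(R)·(μ(E3)·(∫_{Y'} F(C x) + ∫_{E3} F(C x)) − μ(N)·∫_{E3} F(C x)) ≤ μ(E3)·μ(N)·(∫_O F(C x) − μ(O)·∫ F(C x))`,
i.e. `Cov(F(C x), 1{x↔o}) ≥ μ(o↔y, y↮x)·(E[F(C x) | N] − E[F(C x) | N ∩ {x↮y}])`.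
Harris on `{o↔x} ∪ {o↔y}` plus van den Berg–Häggström–Kahn's Thm 2.1 (`q = 1`) for `S = {x}`, `T = {o, y}`, combined by an exact identity.
[cite: VandenbergHaggstromKahn2005, Thm. 2.1 (p. 9), §1 p. 6] [cite: KozmaNitzan2024, Question 8 (§5.5 p. 36)] -/
theorem pocket_fourPoint (w : Sym2 V → unitInterval) (o x y : V) (F : Set V → ℝ)
    (hF : ∀ S T : Set V, S ⊆ T → F S ≤ F T) (hF0 : ∀ S, 0 ≤ F S) :
    (prodBernoulli w).real (({ω : BondConfig V | ¬ (openGraph ω).Reachable x o} ∩ {ω | ¬ (openGraph ω).Reachable x y}) ∩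
          openConn o y) *
      ((prodBernoulli w).real ({ω : BondConfig V | ¬ (openGraph ω).Reachable x o} ∩ {ω | ¬ (openGraph ω).Reachable x y} ∩
            {ω | ¬ (openGraph ω).Reachable o y}) *
          (∫ ω in openConn x y ∩ {ω | ¬ (openGraph ω).Reachable x o}, F (openCluster ω x) ∂(prodBernoulli w) +
            ∫ ω in {ω : BondConfig V | ¬ (openGraph ω).Reachable x o} ∩ {ω | ¬ (openGraph ω).Reachable x y} ∩
              {ω | ¬ (openGraph ω).Reachable o y}, F (openCluster ω x) ∂(prodBernoulli w)) -
        (prodBernoulli w).real ({ω : BondConfig V | ¬ (openGraph ω).Reachable o x} ∩ {ω | ¬ (openGraph ω).Reachable o y}) *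
          ∫ ω in {ω : BondConfig V | ¬ (openGraph ω).Reachable x o} ∩ {ω | ¬ (openGraph ω).Reachable x y} ∩
              {ω | ¬ (openGraph ω).Reachable o y}, F (openCluster ω x) ∂(prodBernoulli w)) ≤
    (prodBernoulli w).real ({ω : BondConfig V | ¬ (openGraph ω).Reachable x o} ∩ {ω | ¬ (openGraph ω).Reachable x y} ∩
          {ω | ¬ (openGraph ω).Reachable o y}) *
      (prodBernoulli w).real ({ω : BondConfig V | ¬ (openGraph ω).Reachable o x} ∩ {ω | ¬ (openGraph ω).Reachable o y}) *
      (∫ ω in openConn x o, F (openCluster ω x) ∂(prodBernoulli w) -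
        (prodBernoulli w).real (openConn x o) * ∫ ω, F (openCluster ω x) ∂(prodBernoulli w)) := by
  classical
  set μ := prodBernoulli w with hμ
  set f : BondConfig V → ℝ := fun ω => F (openCluster ω x) with hf
  have hmeas : ∀ S' : Set (BondConfig V), MeasurableSet S' := fun _ => MeasurableSet.of_discrete
  have hint : ∀ (g : BondConfig V → ℝ) (S' : Set (BondConfig V)), IntegrableOn g S' μ :=
    fun g S' => (Integrable.of_finite).integrableOn
  have hn := fun (S' : Set (BondConfig V)) => (measureReal_nonneg : 0 ≤ μ.real S')
  -- the four cells
  set O : Set (BondConfig V) := openConn x o with hO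
  set Yp : Set (BondConfig V) := openConn x y ∩ {ω | ¬ (openGraph ω).Reachable x o} with hYp
  set E3 : Set (BondConfig V) := {ω : BondConfig V | ¬ (openGraph ω).Reachable x o} ∩ {ω | ¬ (openGraph ω).Reachable x y} ∩
      {ω | ¬ (openGraph ω).Reachable o y} with hE3
  set R : Set (BondConfig V) := ({ω : BondConfig V | ¬ (openGraph ω).Reachable x o} ∩ {ω | ¬ (openGraph ω).Reachable x y}) ∩
      openConn o y with hR
  set N : Set (BondConfig V) := {ω : BondConfig V | ¬ (openGraph ω).Reachable o x} ∩ {ω | ¬ (openGraph ω).Reachable o y} with hN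
  set T0 : Set (BondConfig V) := {ω : BondConfig V | ¬ (openGraph ω).Reachable x o} ∩ {ω | ¬ (openGraph ω).Reachable x y} with hT0
  set U : Set (BondConfig V) := openConn o x ∪ openConn o y with hU
  set m : ℝ := ∫ ω, f ω ∂μ with hm
  -- set identities
  have hNeq : N = Yp ∪ E3 := by
    ext ω
    simp only [hN, hYp, hE3, mem_inter_iff, mem_union, mem_setOf_eq, openConn]
    constructor
    · rintro ⟨hox, hoy⟩
      by_cases hxy : (openGraph ω).Reachable x y
      · exact Or.inl ⟨hxy, fun h => hox h.symm⟩
      · exact Or.inr ⟨⟨fun h => hox h.symm, hxy⟩, hoy⟩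
    · rintro (⟨hxy, hxo⟩ | ⟨⟨hxo, hxy⟩, hoy⟩)
      · exact ⟨fun h => hxo h.symm, fun h => hxo (hxy.trans h.symm)⟩
      · exact ⟨fun h => hxo h.symm, hoy⟩
  have hdYE : Disjoint Yp E3 := by
    rw [Set.disjoint_left]
    rintro ω ⟨hxy, -⟩ ⟨⟨-, hxy'⟩, -⟩
    exact hxy' hxy
  have hUeq : U = O ∪ R := by
    ext ω
    simp only [hU, hO, hR, mem_inter_iff, mem_union, mem_setOf_eq, openConn]
    constructor
    · rintro (hox | hoy)
      · exact Or.inl hox.symm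
      · by_cases hxo : (openGraph ω).Reachable x o
        · exact Or.inl hxo
        · exact Or.inr ⟨⟨hxo, fun hxy => hxo (hxy.trans hoy.symm)⟩, hoy⟩
    · rintro (hxo | ⟨⟨-, -⟩, hoy⟩)
      · exact Or.inl hxo.symm
      · exact Or.inr hoy
  have hdOR : Disjoint O R := by
    rw [Set.disjoint_left]
    rintro ω hxo ⟨⟨hxo', -⟩, -⟩
    exact hxo' hxo
  have hT0eq : T0 = E3 ∪ R := by
    ext ω
    simp only [hT0, hE3, hR, mem_inter_iff, mem_union, mem_setOf_eq, openConn]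
    constructor
    · rintro ⟨hxo, hxy⟩
      by_cases hoy : (openGraph ω).Reachable o y
      · exact Or.inr ⟨⟨hxo, hxy⟩, hoy⟩
      · exact Or.inl ⟨⟨hxo, hxy⟩, hoy⟩
    · rintro (⟨⟨hxo, hxy⟩, -⟩ | ⟨⟨hxo, hxy⟩, -⟩)
      · exact ⟨hxo, hxy⟩
      · exact ⟨hxo, hxy⟩
  have hdER : Disjoint E3 R := by
    rw [Set.disjoint_left]
    rintro ω ⟨-, hoy⟩ ⟨-, hoy'⟩
    exact hoy hoy'
  have hT0R : T0 ∩ openConn o y = R := rfl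
  -- the whole space: `univ = (O ∪ R) ∪ (Yp ∪ E3)` (i.e. `U ⊔ N`)
  have hUN : Disjoint (O ∪ R) (Yp ∪ E3) := by
    rw [Set.disjoint_left]
    rintro ω (hxo | ⟨⟨hxo, hxy⟩, hoy⟩) (⟨hxy', hxo'⟩ | ⟨⟨hxo', hxy'⟩, hoy'⟩)
    · exact hxo' hxo
    · exact hxo' hxo
    · exact hxy hxy'
    · exact hoy' hoy
  have huniv : (O ∪ R) ∪ (Yp ∪ E3) = univ := by
    rw [← hUeq, ← hNeq]
    ext ω
    simp only [hU, hN, mem_union, mem_inter_iff, mem_setOf_eq, mem_univ, iff_true, openConn]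
    by_cases hox : (openGraph ω).Reachable o x
    · exact Or.inl (Or.inl hox)
    · by_cases hoy : (openGraph ω).Reachable o y
      · exact Or.inl (Or.inr hoy)
      · exact Or.inr ⟨hox, hoy⟩
  -- masses and integrals over the cells
  have eN : μ.real N = μ.real Yp + μ.real E3 := by rw [hNeq, measureReal_union hdYE (hmeas _)]
  have eU : μ.real U = μ.real O + μ.real R := by rw [hUeq, measureReal_union hdOR (hmeas _)]
  have eT0 : μ.real T0 = μ.real E3 + μ.real R := by rw [hT0eq, measureReal_union hdER (hmeas _)]
  have e1 : 1 = (μ.real O + μ.real R) + (μ.real Yp + μ.real E3) := by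
    rw [← measureReal_union hdOR (hmeas _), ← measureReal_union hdYE (hmeas _), ← measureReal_union hUN (hmeas _), huniv,
      probReal_univ]
  have iU : ∫ ω in U, f ω ∂μ = ∫ ω in O, f ω ∂μ + ∫ ω in R, f ω ∂μ := by
    rw [hUeq, setIntegral_union hdOR (hmeas _) (hint _ _) (hint _ _)]
  have iT0 : ∫ ω in T0, f ω ∂μ = ∫ ω in E3, f ω ∂μ + ∫ ω in R, f ω ∂μ := by
    rw [hT0eq, setIntegral_union hdER (hmeas _) (hint _ _) (hint _ _)]
  have im : m = (∫ ω in O, f ω ∂μ + ∫ ω in R, f ω ∂μ) + (∫ ω in Yp, f ω ∂μ + ∫ ω in E3, f ω ∂μ) := by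
    rw [← setIntegral_union hdOR (hmeas _) (hint _ _) (hint _ _), ← setIntegral_union hdYE (hmeas _) (hint _ _) (hint _ _),
      ← setIntegral_union hUN (hmeas _) (hint _ _) (hint _ _), huniv, setIntegral_univ]
  -- (1) Harris on `U = {o↔x} ∪ {o↔y}`
  have hHarris : μ.real U * m ≤ ∫ ω in U, f ω ∂μ :=
    AGloc.setIntegral_clusterFun_ge w x F hF hF0 U ((isUpperSet_openConn o x).union (isUpperSet_openConn o y))
  -- (2) van den Berg–Häggström–Kahn Thm 2.1 for `S = {x}`, `T = {o, y}`: `F(C x)` vs `1{o↔y}` given `x ↮ {o,y}`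
  set S : Set V := {x} with hS
  set T : Set V := {o, y} with hT
  set Fe : Set (Sym2 V) → ℝ := fun C => F (openCluster C x) with hFe
  set Ge : Set (Sym2 V) → ℝ := fun C => if (openGraph C).Reachable o y then 1 else 0 with hGe
  have hFe_mono : Monotone Fe := fun C C' hCC' => hF _ _ (openCluster_mono hCC' x)
  have hGe_mono : Monotone Ge := by
    intro C C' hCC'
    simp only [hGe]
    by_cases h : (openGraph C).Reachable o y
    · rw [if_pos h, if_pos (h.mono (openGraph_mono hCC'))]
    · rw [if_neg h]; split_ifs <;> norm_num
  have hD_ST : {ω : BondConfig V | ∀ s ∈ S, ∀ t ∈ T, ¬ (openGraph ω).Reachable s t} = T0 := by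
    ext ω
    simp only [hS, hT, hT0, mem_setOf_eq, mem_inter_iff, mem_insert_iff, mem_singleton_iff, forall_eq_or_imp, forall_eq]
  have hFe_eq : ∀ ω : BondConfig V, Fe (⋃ s ∈ S, openEdgeCluster ω s) = f ω := by
    intro ω
    simp only [hFe, hf]
    congr 1
    ext a
    exact (KNSep.reachable_iff_cluster ω S (show x ∈ S by simp [hS]) a).symm
  have hGe_eq : ∀ ω : BondConfig V, Ge (⋃ t ∈ T, openEdgeCluster ω t) = (openConn o y : Set (BondConfig V)).indicator 1 ω := by
    intro ω
    simp only [hGe]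
    rw [← KNSep.reachable_iff_cluster ω T (show o ∈ T by simp [hT]) y]
    by_cases h : (openGraph ω).Reachable o y
    · rw [if_pos h, indicator_of_mem (show ω ∈ openConn o y from h), Pi.one_apply]
    · rw [if_neg h, indicator_of_notMem (show ω ∉ openConn o y from h)]
  have hBHK := BHK2006_twoSetConditionalAssociation.negCorrelation w S T Fe Ge hFe_mono hGe_mono
  rw [hD_ST] at hBHK
  simp_rw [hFe_eq, hGe_eq] at hBHK
  rw [setIntegral_mul_indicator_one μ T0 (openConn o y) f, setIntegral_indicator_one_eq μ T0 (openConn o y), hT0R] at hBHK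
  -- hBHK : μ T0 * ∫_R f ≤ (∫_{T0} f) * μ R
  -- assemble via the identity
  --   μ(E3)μ(N)(I_O − μ(O) m) − μ(R)(μ(E3) I_N − μ(N) I_E3) = μ(E3)(μ(N)+μ(R))·[I_U − μ(U) m] + μ(N)·[μ(R) I_T0 − μ(T0) I_R]
  rw [iU] at hHarris
  rw [iT0] at hBHK
  rw [eU] at hHarris
  rw [eT0] at hBHK
  have h1 : 0 ≤ (μ.real E3 * (μ.real N + μ.real R)) *
      ((∫ ω in O, f ω ∂μ + ∫ ω in R, f ω ∂μ) - (μ.real O + μ.real R) * m) :=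
    mul_nonneg (mul_nonneg (hn E3) (add_nonneg (hn N) (hn R))) (by linarith)
  have h2 : 0 ≤ μ.real N * (μ.real R * (∫ ω in E3, f ω ∂μ + ∫ ω in R, f ω ∂μ) - (μ.real E3 + μ.real R) * ∫ ω in R, f ω ∂μ) :=
    mul_nonneg (hn N) (by linarith)
  have key : μ.real E3 * μ.real N * (∫ ω in O, f ω ∂μ - μ.real O * m) -
      μ.real R * (μ.real E3 * (∫ ω in Yp, f ω ∂μ + ∫ ω in E3, f ω ∂μ) - μ.real N * ∫ ω in E3, f ω ∂μ) =
      (μ.real E3 * (μ.real N + μ.real R)) * ((∫ ω in O, f ω ∂μ + ∫ ω in R, f ω ∂μ) - (μ.real O + μ.real R) * m) +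
        μ.real N * (μ.real R * (∫ ω in E3, f ω ∂μ + ∫ ω in R, f ω ∂μ) - (μ.real E3 + μ.real R) * ∫ ω in R, f ω ∂μ) := by
    rw [im, eN]
    linear_combination (-(μ.real E3 * μ.real R *
      ((∫ ω in O, f ω ∂μ + ∫ ω in R, f ω ∂μ) + (∫ ω in Yp, f ω ∂μ + ∫ ω in E3, f ω ∂μ)))) * e1
  have : 0 ≤ μ.real E3 * μ.real N * (∫ ω in O, f ω ∂μ - μ.real O * m) -
      μ.real R * (μ.real E3 * (∫ ω in Yp, f ω ∂μ + ∫ ω in E3, f ω ∂μ) - μ.real N * ∫ ω in E3, f ω ∂μ) := by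
    rw [key]; exact add_nonneg h1 h2
  have := sub_nonneg.1 this
  simpa only [hf, mul_assoc] using this

end PocketCert

end

end Summit.CriticalPhenomena.PercolationContinuityZ3.Theorems
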